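import Mathlib
import Summits.AnomalousDissipation.AnomalousDissipation.Theorems.SolenoidalFractalHomogenisationLagrangianStepW7BandTools
import Summits.AnomalousDissipation.AnomalousDissipation.Theorems.SolenoidalFractalHomogenisationLagrangianStepCellChainFastEnergy
import HarnessLib

/-!
# K1L_D (stmt-AnomalousDissipation-27980), (ℓ3) (D-TH) — THE BAND STEP: the W7 hypocoercivity functional for a FINITE FAMILY of coupled chains WITH FORCING
# (one energy, one `ε`, Cauchy–Schwarz-able slack) (helper; `--supports stmt-AnomalousDissipation-27980 --as helper`)

Engine addition (E-b1)+(E-b2) promised in `HOME/ad-sawtooth-k1loc-p1/g16/DTH-premise-answer-k1locp1g16.md` §4 (answer to L24 §5 / RULING D28-22 (3), trigger (T-b)); prover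
ad-sawtooth-k1loc-p1 g16.  `W7Slot.slot_stepR` (p725843) runs ONE chain with the whole energy as `E`; a variable frame couples the chains of a band through zero-order
forcing terms, which enter the functional ONLY through the cross terms and must be absorbed ACROSS chains (memo §3).  This file is the frame-agnostic real-analysis
object the un-freezing glue ((D-TH)₁, lead L24) instantiates:
* a finite index set `ι` of slow chains `q0 i, qp i, qm i` (real wave vectors) with modes `w0 i, wp i, wm i, wpp i, wmm i`, GENERIC dampings `y_j i` and FORCING terms
  `f0 i, fp i, fm i` in the chain ODE (`ẇ₀ = dW0R + f₀`, …), link constants `c i ∈ [cbar, chi]`, drain floors `qd i ≥ qbar`, slow coercivities `d0 i`, a COMMON `ε`,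
  ONE energy `E` with `E' = −2Q`, the dissipation split over ALL chains `Q ≥ μ Σ_i Σ_j Re⟪y_j i, w_j i⟫ + (dmin/2)(E − μ Σ_i Σ_j ‖w_j i‖²)`;
* the functional `Φ = E + μ·ε·Σ_i X_i`, `X_i = (c i·A)·Re⟪w₀ⁱ, P₀ⁱ(w₊ⁱ − w₋ⁱ)⟫`;
* the FORCING HYPOTHESIS in summed, explicitly shaped slack form (a.e. on the slot):
  `μ ε Σ_i (c i·A)·(‖f₀ⁱ‖(‖w₊ⁱ‖+‖w₋ⁱ‖) + ‖w₀ⁱ‖(‖f₊ⁱ‖+‖f₋ⁱ‖)) ≤ μ Σ_i (ε (c i)² (qd i) A²/4·‖w₀ⁱ‖² + (dmin/8)(‖w₊ⁱ‖²+‖w₋ⁱ‖²)) + (dmin/8)·(E − μ Σ_i Σ_j ‖w_j i‖²)`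
  — half of the slow gain, an eighth of the `±`/rest dissipation; this is what Cauchy–Schwarz across chains delivers for couplings of size θ×(chain transport) and
  θ×(dissipation) under `θ ≤ qbar/(4C)`, `θ² ≤ qbar/2` (memo §3);
* CONCLUSION **`band_step`**: `E t₁ ≤ exp(−∫ min(σ_b/(9/8), σ_b/(7/8)))·E t₀`, `σ_b(s) = min(ε·cbar²·qbar·A(s)²/4 − 8ε²chi²/(dmin(t₁−t₀)²), min(7dmin/8, dtwo))`, NO prefactor.
The single chain with forcing (E-b1) is the case `ι = Unit`.  Bricks: `…W7BandTools` (`pointwise_chain_ineq`, `chain_slack_le`, `min_rate_le`, `eps_c_sqrt_two_le`, `sandwich_term_le`); `CellChain.absolutelyContinuousOnInterval_finsetSum`.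
No definitions, no sorry.  NOT a proof of any block, of `stub_W7thg`, of K1L_D or of AD; rung F-D1.A0.
[cite: BedrossianCotiZelati2017, §2 (hypocoercivity functional with a cross term, Grönwall)] [problem: turb]
-/

set_option linter.dupNamespace false

noncomputable section

namespace Summit.AnomalousDissipation.AnomalousDissipation.Theorems.SolenoidalFractalHomogenisation.LagrangianStep.W7Slot

open Set Real MeasureTheory intervalIntegral
open scoped InnerProductSpace
open Literature.Analysis.FluidPDE Literature.Analysis.FluidPDE.Torus
open Summit.AnomalousDissipation.AnomalousDissipation.Theorems.SolenoidalFractalHomogenisation.LagrangianStep.ThreeMode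
open Summit.AnomalousDissipation.AnomalousDissipation.Theorems.SolenoidalFractalHomogenisation.LagrangianStep.W7Engine

/-! ## The band step -/

set_option maxHeartbeats 800000 in
/-- **THE BAND STEP** (W7 hypocoercivity functional for a finite family of coupled chains with forcing; see the module docstring for the shape of every hypothesis).
CONCLUSION: `E t₁ ≤ exp(−∫_{t₀}^{t₁} min(σ_b/(9/8), σ_b/(7/8)))·E t₀`, `σ_b(s) = min(ε·cbar²·qbar·A(s)²/4 − 8ε²·chi²/(dmin(t₁−t₀)²), min(7dmin/8, dtwo))`.
[cite: BedrossianCotiZelati2017, §2 (hypocoercivity functional with a cross term, Grönwall)] -/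
theorem band_step {ι : Type*} [Fintype ι] {q0 qp qm : ι → Fin 3 → ℝ} {t₀ t₁ : ℝ} (hT : t₀ < t₁)
    {w0 wp wm wpp wmm y0 yp ym ypp ymm f0 fp fm : ι → ℝ → (EuclideanSpace ℂ (Fin 3))} {E Q A Ad : ℝ → ℝ}
    {μ ε dmin dtwo Dmax cbar chi qbar : ℝ} {c qd d0 D0 : ι → ℝ}
    (hμ : 0 < μ) (hε : 0 ≤ ε) (hdmin : 0 < dmin) (hdD : dmin ≤ Dmax) (hcbar : 0 ≤ cbar) (hqbar : 0 ≤ qbar)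
    (hc : ∀ i, cbar ≤ c i) (hchi : ∀ i, c i ≤ chi) (hq : ∀ i, qbar ≤ qd i) (hd0 : ∀ i, 0 ≤ d0 i) (hD0 : ∀ i, 0 ≤ D0 i)
    -- the Young constraints, common `ε`
    (c1 : ∀ i, 8 * ε * c i ^ 2 ≤ dmin) (c2 : 4 * ε * Dmax ^ 2 ≤ dmin) (c3 : ∀ i, ε * c i ^ 2 ≤ dtwo)
    (c4 : ∀ i, 32 * ε ^ 2 * c i ^ 2 * D0 i ^ 2 ≤ d0 i * dmin)
    -- the envelope
    (hAc : Continuous A) (hA01 : ∀ t ∈ Icc t₀ t₁, 0 ≤ A t ∧ A t ≤ 1) (hA0 : A t₀ = 0) (hA1 : A t₁ = 0)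
    (hAac : AbsolutelyContinuousOnInterval A t₀ t₁) (hAd : ∀ᵐ t, t ∈ uIcc t₀ t₁ → HasDerivAt A (Ad t) t)
    (hAd2 : ∀ᵐ t, t ∈ uIcc t₀ t₁ → Ad t ^ 2 ≤ 4 / (t₁ - t₀) ^ 2)
    -- per chain: transversality, coercivity, upper bounds, drain floor, absolute continuity, the chain ODE with forcing
    (hT0 : ∀ i, ∀ t ∈ Icc t₀ t₁, rdot (q0 i) (w0 i t) = 0) (hTyp : ∀ i, ∀ t ∈ Icc t₀ t₁, rdot (qp i) (yp i t) = 0)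
    (hTym : ∀ i, ∀ t ∈ Icc t₀ t₁, rdot (qm i) (ym i t) = 0)
    (hg0 : ∀ i, ∀ t ∈ Icc t₀ t₁, d0 i * ‖w0 i t‖ ^ 2 ≤ (⟪y0 i t, w0 i t⟫_ℂ).re)
    (hgp : ∀ i, ∀ t ∈ Icc t₀ t₁, dmin * ‖wp i t‖ ^ 2 ≤ (⟪yp i t, wp i t⟫_ℂ).re) (hgm : ∀ i, ∀ t ∈ Icc t₀ t₁, dmin * ‖wm i t‖ ^ 2 ≤ (⟪ym i t, wm i t⟫_ℂ).re)
    (hgpp : ∀ i, ∀ t ∈ Icc t₀ t₁, dtwo * ‖wpp i t‖ ^ 2 ≤ (⟪ypp i t, wpp i t⟫_ℂ).re)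
    (hgmm : ∀ i, ∀ t ∈ Icc t₀ t₁, dtwo * ‖wmm i t‖ ^ 2 ≤ (⟪ymm i t, wmm i t⟫_ℂ).re)
    (hYp : ∀ i, ∀ t ∈ Icc t₀ t₁, ‖yp i t‖ ≤ Dmax * ‖wp i t‖) (hYm : ∀ i, ∀ t ∈ Icc t₀ t₁, ‖ym i t‖ ≤ Dmax * ‖wm i t‖)
    (hY0 : ∀ i, ∀ t ∈ Icc t₀ t₁, ‖y0 i t‖ ≤ D0 i * ‖w0 i t‖)
    (hqw : ∀ i, ∀ t ∈ Icc t₀ t₁, qd i * ‖w0 i t‖ ^ 2 ≤ ‖transversalProjR (qp i) (w0 i t)‖ ^ 2 + ‖transversalProjR (qm i) (w0 i t)‖ ^ 2)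
    (h0ac : ∀ i, AbsolutelyContinuousOnInterval (w0 i) t₀ t₁) (hpac : ∀ i, AbsolutelyContinuousOnInterval (wp i) t₀ t₁)
    (hmac : ∀ i, AbsolutelyContinuousOnInterval (wm i) t₀ t₁)
    (hd0' : ∀ i, ∀ᵐ t, t ∈ uIcc t₀ t₁ → HasDerivAt (w0 i) (dW0R (c i * A t) (q0 i) (wp i t) (wm i t) (y0 i t) + f0 i t) t)
    (hdp' : ∀ i, ∀ᵐ t, t ∈ uIcc t₀ t₁ → HasDerivAt (wp i) (dWpR (c i * A t) (qp i) (w0 i t) (wpp i t) (yp i t) + fp i t) t)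
    (hdm' : ∀ i, ∀ᵐ t, t ∈ uIcc t₀ t₁ → HasDerivAt (wm i) (dWmR (c i * A t) (qm i) (w0 i t) (wmm i t) (ym i t) + fm i t) t)
    -- the energy, the dissipation split over all chains, the forcing slack
    (hEac : AbsolutelyContinuousOnInterval E t₀ t₁) (hEd : ∀ᵐ t, t ∈ uIcc t₀ t₁ → HasDerivAt E (-2 * Q t) t)
    (hE5 : ∀ t ∈ Icc t₀ t₁, μ * ∑ i, (‖w0 i t‖ ^ 2 + ‖wp i t‖ ^ 2 + ‖wm i t‖ ^ 2 + ‖wpp i t‖ ^ 2 + ‖wmm i t‖ ^ 2) ≤ E t)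
    (hQ : ∀ᵐ t, t ∈ uIcc t₀ t₁ →
      μ * ∑ i, ((⟪y0 i t, w0 i t⟫_ℂ).re + (⟪yp i t, wp i t⟫_ℂ).re + (⟪ym i t, wm i t⟫_ℂ).re + (⟪ypp i t, wpp i t⟫_ℂ).re + (⟪ymm i t, wmm i t⟫_ℂ).re)
        + (dmin / 2) * (E t - μ * ∑ i, (‖w0 i t‖ ^ 2 + ‖wp i t‖ ^ 2 + ‖wm i t‖ ^ 2 + ‖wpp i t‖ ^ 2 + ‖wmm i t‖ ^ 2)) ≤ Q t)
    (hF : ∀ᵐ t, t ∈ uIcc t₀ t₁ →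
      μ * (ε * ∑ i, (c i * A t) * (‖f0 i t‖ * (‖wp i t‖ + ‖wm i t‖) + ‖w0 i t‖ * (‖fp i t‖ + ‖fm i t‖)))
        ≤ μ * ∑ i, (ε * c i ^ 2 * qd i * A t ^ 2 / 4 * ‖w0 i t‖ ^ 2 + dmin / 8 * (‖wp i t‖ ^ 2 + ‖wm i t‖ ^ 2))
          + dmin / 8 * (E t - μ * ∑ i, (‖w0 i t‖ ^ 2 + ‖wp i t‖ ^ 2 + ‖wm i t‖ ^ 2 + ‖wpp i t‖ ^ 2 + ‖wmm i t‖ ^ 2))) :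
    E t₁ ≤ Real.exp (-∫ s in t₀..t₁,
        min ((min (ε * cbar ^ 2 * qbar * A s ^ 2 / 4 - 8 * ε ^ 2 * chi ^ 2 / (dmin * (t₁ - t₀) ^ 2)) (min (7 * dmin / 8) dtwo)) / (9 / 8))
            ((min (ε * cbar ^ 2 * qbar * A s ^ 2 / 4 - 8 * ε ^ 2 * chi ^ 2 / (dmin * (t₁ - t₀) ^ 2)) (min (7 * dmin / 8) dtwo)) / (7 / 8))) * E t₀ := by
  have ht : t₀ ≤ t₁ := hT.le
  have hIcc : uIcc t₀ t₁ = Icc t₀ t₁ := uIcc_of_le ht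
  have hTpos : 0 < t₁ - t₀ := sub_pos.2 hT
  have hci : ∀ i, 0 ≤ c i := fun i => hcbar.trans (hc i)
  -- abbreviations
  set Y : ι → ℝ → ℝ := fun i t => (⟪w0 i t, transversalProjR (q0 i) (wp i t - wm i t)⟫_ℂ).re with hY
  set X : ι → ℝ → ℝ := fun i t => (c i * A t) * Y i t with hX
  set Φ : ℝ → ℝ := fun t => E t + μ * (ε * ∑ i, X i t) with hΦ
  set N5 : ι → ℝ → ℝ := fun i t => ‖w0 i t‖ ^ 2 + ‖wp i t‖ ^ 2 + ‖wm i t‖ ^ 2 + ‖wpp i t‖ ^ 2 + ‖wmm i t‖ ^ 2 with hN5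
  set σ : ℝ → ℝ := fun s => min (ε * cbar ^ 2 * qbar * A s ^ 2 / 4 - 8 * ε ^ 2 * chi ^ 2 / (dmin * (t₁ - t₀) ^ 2)) (min (7 * dmin / 8) dtwo) with hσ
  have hXbR : ∀ i t, X i t = (⟪w0 i t, bR (c i * A t) (q0 i) (wp i t) (wm i t)⟫_ℂ).re := fun i t => by rw [hX, hY, re_inner_bR]
  -- (1) the per-chain pointwise form inequality on the slot
  have hform : ∀ i, ∀ t ∈ Icc t₀ t₁,
      -2 * ((⟪y0 i t, w0 i t⟫_ℂ).re + (⟪yp i t, wp i t⟫_ℂ).re + (⟪ym i t, wm i t⟫_ℂ).re + (⟪ypp i t, wpp i t⟫_ℂ).re + (⟪ymm i t, wmm i t⟫_ℂ).re)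
        + ε * xdotR (c i * A t) (q0 i) (qp i) (qm i) (w0 i t) (wp i t) (wm i t) (wpp i t) (wmm i t) (y0 i t) (yp i t) (ym i t)
      ≤ -(ε * (c i * A t) ^ 2 / 2) * (‖transversalProjR (qp i) (w0 i t)‖ ^ 2 + ‖transversalProjR (qm i) (w0 i t)‖ ^ 2)
        - (5 * dmin / 4) * (‖wp i t‖ ^ 2 + ‖wm i t‖ ^ 2) - dtwo * (‖wpp i t‖ ^ 2 + ‖wmm i t‖ ^ 2) - (7 * d0 i / 4) * ‖w0 i t‖ ^ 2 := by
    intro i t htI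
    obtain ⟨hA0t, hA1t⟩ := hA01 t htI
    have hl : 0 ≤ c i * A t := mul_nonneg (hci i) hA0t
    have hA2 : (c i * A t) ^ 2 ≤ c i ^ 2 := by
      rw [mul_pow]; nlinarith [sq_nonneg (c i), mul_le_one₀ hA1t hA0t hA1t]
    have c1' : 8 * ε * (c i * A t) ^ 2 ≤ dmin := by
      have h := mul_le_mul_of_nonneg_left hA2 (by positivity : 0 ≤ 8 * ε)
      linarith [c1 i]
    have c3' : ε * (c i * A t) ^ 2 ≤ dtwo := by
      have h := mul_le_mul_of_nonneg_left hA2 hε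
      linarith [c3 i]
    have c4' : 32 * ε ^ 2 * (c i * A t) ^ 2 * D0 i ^ 2 ≤ d0 i * dmin := by
      have h := mul_le_mul_of_nonneg_left hA2 (by positivity : 0 ≤ 32 * ε ^ 2 * D0 i ^ 2)
      nlinarith [h, c4 i]
    exact threeModeR3_form_le (c i * A t) ε (d0 i) dmin dmin dtwo dtwo dmin dtwo Dmax (D0 i) (q0 i) (qp i) (qm i) (w0 i t) (wp i t) (wm i t) (wpp i t) (wmm i t)
      (y0 i t) (yp i t) (ym i t) (ypp i t) (ymm i t) (hT0 i t htI) (hTyp i t htI) (hTym i t htI) hl hε (hd0 i) hdmin.le (hD0 i)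
      (hg0 i t htI) (hgp i t htI) (hgm i t htI) (hgpp i t htI) (hgmm i t htI) (hYp i t htI) (hYm i t htI) (hY0 i t htI)
      le_rfl le_rfl le_rfl le_rfl c1' c2 c3' c4'
  -- (2) per chain: a.e. derivative of `X i` = `c·Ȧ·Y + xdotR + F` with the forcing pairing `F`, and `|F| ≤ cA(‖f₀‖(‖w₊‖+‖w₋‖) + ‖w₀‖(‖f₊‖+‖f₋‖))`
  have hXd : ∀ i, ∀ᵐ t, t ∈ uIcc t₀ t₁ → ∃ F : ℝ,
      HasDerivAt (X i) (c i * Ad t * Y i t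
        + xdotR (c i * A t) (q0 i) (qp i) (qm i) (w0 i t) (wp i t) (wm i t) (wpp i t) (wmm i t) (y0 i t) (yp i t) (ym i t) + F) t ∧
      |F| ≤ (c i * A t) * (‖f0 i t‖ * (‖wp i t‖ + ‖wm i t‖) + ‖w0 i t‖ * (‖fp i t‖ + ‖fm i t‖)) := by
    intro i
    filter_upwards [hd0' i, hdp' i, hdm' i, hAd] with t h0 hp hm hA htI
    have htI' : t ∈ Icc t₀ t₁ := by rwa [hIcc] at htI
    specialize h0 htI; specialize hp htI; specialize hm htI; specialize hA htI
    set P0 : (EuclideanSpace ℂ (Fin 3)) →L[ℂ] (EuclideanSpace ℂ (Fin 3)) := transversalProjR (q0 i) with hP0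
    set dp := dWpR (c i * A t) (qp i) (w0 i t) (wpp i t) (yp i t) with hdp_def
    set dm := dWmR (c i * A t) (qm i) (w0 i t) (wmm i t) (ym i t) with hdm_def
    set d0v := dW0R (c i * A t) (q0 i) (wp i t) (wm i t) (y0 i t) with hd0_def
    have hg : HasDerivAt (fun s => P0 (wp i s - wm i s)) (P0 ((dp + fp i t) - (dm + fm i t))) t :=
      (P0.restrictScalars ℝ).hasFDerivAt.comp_hasDerivAt t (hp.sub hm)
    have hinner := h0.inner ℂ hg
    have hYd : HasDerivAt (Y i) ((⟪w0 i t, P0 ((dp + fp i t) - (dm + fm i t))⟫_ℂ + ⟪d0v + f0 i t, P0 (wp i t - wm i t)⟫_ℂ).re) t := by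
      have h := Complex.reCLM.hasFDerivAt.comp_hasDerivAt t hinner
      simpa only [Function.comp_def, Complex.reCLM_apply] using h
    have hXd' : HasDerivAt (X i) (c i * Ad t * Y i t + c i * A t *
        ((⟪w0 i t, P0 ((dp + fp i t) - (dm + fm i t))⟫_ℂ + ⟪d0v + f0 i t, P0 (wp i t - wm i t)⟫_ℂ).re)) t := (hA.const_mul (c i)).mul hYd
    -- split off the forcing pairing
    set F : ℝ := c i * A t * ((⟪w0 i t, P0 (fp i t - fm i t)⟫_ℂ).re + (⟪f0 i t, P0 (wp i t - wm i t)⟫_ℂ).re) with hF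
    have hsplit : c i * A t * ((⟪w0 i t, P0 ((dp + fp i t) - (dm + fm i t))⟫_ℂ + ⟪d0v + f0 i t, P0 (wp i t - wm i t)⟫_ℂ).re)
        = xdotR (c i * A t) (q0 i) (qp i) (qm i) (w0 i t) (wp i t) (wm i t) (wpp i t) (wmm i t) (y0 i t) (yp i t) (ym i t) + F := by
      have e1 : (dp + fp i t) - (dm + fm i t) = (dp - dm) + (fp i t - fm i t) := by abel
      rw [e1, map_add, inner_add_right, inner_add_left, Complex.add_re, Complex.add_re, Complex.add_re,
        ← l_mul_Ydot_eq_xdotR (c i * A t) (q0 i) (qp i) (qm i) (w0 i t) (wp i t) (wm i t) (wpp i t) (wmm i t) (y0 i t) (yp i t) (ym i t), hF]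
      ring
    refine ⟨F, ?_, ?_⟩
    · rw [hsplit] at hXd'; convert hXd' using 1; ring
    · have hl : 0 ≤ c i * A t := mul_nonneg (hci i) (hA01 t htI').1
      have b1 : |(⟪w0 i t, P0 (fp i t - fm i t)⟫_ℂ).re| ≤ ‖w0 i t‖ * (‖fp i t‖ + ‖fm i t‖) := by
        calc |(⟪w0 i t, P0 (fp i t - fm i t)⟫_ℂ).re| ≤ ‖⟪w0 i t, P0 (fp i t - fm i t)⟫_ℂ‖ := Complex.abs_re_le_norm _
          _ ≤ ‖w0 i t‖ * ‖P0 (fp i t - fm i t)‖ := norm_inner_le_norm _ _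
          _ ≤ ‖w0 i t‖ * ‖fp i t - fm i t‖ := mul_le_mul_of_nonneg_left (norm_transversalProjR_le _ _) (norm_nonneg _)
          _ ≤ ‖w0 i t‖ * (‖fp i t‖ + ‖fm i t‖) := mul_le_mul_of_nonneg_left (norm_sub_le _ _) (norm_nonneg _)
      have b2 : |(⟪f0 i t, P0 (wp i t - wm i t)⟫_ℂ).re| ≤ ‖f0 i t‖ * (‖wp i t‖ + ‖wm i t‖) := by
        calc |(⟪f0 i t, P0 (wp i t - wm i t)⟫_ℂ).re| ≤ ‖⟪f0 i t, P0 (wp i t - wm i t)⟫_ℂ‖ := Complex.abs_re_le_norm _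
          _ ≤ ‖f0 i t‖ * ‖P0 (wp i t - wm i t)‖ := norm_inner_le_norm _ _
          _ ≤ ‖f0 i t‖ * ‖wp i t - wm i t‖ := mul_le_mul_of_nonneg_left (norm_transversalProjR_le _ _) (norm_nonneg _)
          _ ≤ ‖f0 i t‖ * (‖wp i t‖ + ‖wm i t‖) := mul_le_mul_of_nonneg_left (norm_sub_le _ _) (norm_nonneg _)
      rw [hF, abs_mul, abs_of_nonneg hl]
      refine mul_le_mul_of_nonneg_left ?_ hl
      have := abs_add_le ((⟪w0 i t, P0 (fp i t - fm i t)⟫_ℂ).re) ((⟪f0 i t, P0 (wp i t - wm i t)⟫_ℂ).re)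
      linarith
  -- (3) the a.e. derivative of `Φ` and `Φ' ≤ −σ E`
  have hXd_all : ∀ᵐ t, ∀ i, t ∈ uIcc t₀ t₁ → ∃ F : ℝ,
      HasDerivAt (X i) (c i * Ad t * Y i t
        + xdotR (c i * A t) (q0 i) (qp i) (qm i) (w0 i t) (wp i t) (wm i t) (wpp i t) (wmm i t) (y0 i t) (yp i t) (ym i t) + F) t ∧
      |F| ≤ (c i * A t) * (‖f0 i t‖ * (‖wp i t‖ + ‖wm i t‖) + ‖w0 i t‖ * (‖fp i t‖ + ‖fm i t‖)) :=
    ae_all_iff.2 hXd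
  have hderiv : ∀ᵐ t, t ∈ uIcc t₀ t₁ → ∃ φ : ℝ, HasDerivAt Φ φ t ∧ φ ≤ -σ t * E t := by
    filter_upwards [hXd_all, hAd2, hEd, hQ, hF] with t hXt hA2 hE hQt hFt htI
    have htI' : t ∈ Icc t₀ t₁ := by rwa [hIcc] at htI
    specialize hA2 htI; specialize hE htI; specialize hQt htI; specialize hFt htI
    have hformt := fun i => hform i t htI'
    have hqwt := fun i => hqw i t htI'
    have hE5t := hE5 t htI'
    choose Fi hFi using fun i => hXt i htI
    -- per-chain abbreviations at time `t`
    set S5 : ι → ℝ := fun i => (⟪y0 i t, w0 i t⟫_ℂ).re + (⟪yp i t, wp i t⟫_ℂ).re + (⟪ym i t, wm i t⟫_ℂ).re + (⟪ypp i t, wpp i t⟫_ℂ).re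
      + (⟪ymm i t, wmm i t⟫_ℂ).re with hS5
    set n5 : ι → ℝ := fun i => ‖w0 i t‖ ^ 2 + ‖wp i t‖ ^ 2 + ‖wm i t‖ ^ 2 + ‖wpp i t‖ ^ 2 + ‖wmm i t‖ ^ 2 with hn5
    set xd : ι → ℝ := fun i => xdotR (c i * A t) (q0 i) (qp i) (qm i) (w0 i t) (wp i t) (wm i t) (wpp i t) (wmm i t) (y0 i t) (yp i t) (ym i t) with hxd
    set G : ι → ℝ := fun i => ε * c i ^ 2 * qd i * A t ^ 2 / 4 * ‖w0 i t‖ ^ 2 + dmin / 8 * (‖wp i t‖ ^ 2 + ‖wm i t‖ ^ 2) with hG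
    set Fb : ι → ℝ := fun i => (c i * A t) * (‖f0 i t‖ * (‖wp i t‖ + ‖wm i t‖) + ‖w0 i t‖ * (‖fp i t‖ + ‖fm i t‖)) with hFb
    set R : ℝ := E t - μ * ∑ i, n5 i with hR
    have hR0 : 0 ≤ R := by rw [hR]; linarith [hE5t]
    have hEeq : E t = μ * ∑ i, n5 i + R := by rw [hR]; ring
    -- derivative of Φ
    have hsumd : HasDerivAt (fun s => ∑ i, X i s) (∑ i, (c i * Ad t * Y i t + xd i + Fi i)) t :=
      HasDerivAt.fun_sum fun i _ => (hFi i).1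
    have hΦd : HasDerivAt Φ (-2 * Q t + μ * (ε * ∑ i, (c i * Ad t * Y i t + xd i + Fi i))) t :=
      hE.add ((hsumd.const_mul ε).const_mul μ)
    refine ⟨_, hΦd, ?_⟩
    -- the slow coefficient after the slack: `ε c²(q A²/4) − 8ε²c²/(dmin T²) ≥ ρ̄`
    set ρbar : ℝ := ε * cbar ^ 2 * qbar * A t ^ 2 / 4 - 8 * ε ^ 2 * chi ^ 2 / (dmin * (t₁ - t₀) ^ 2) with hρbar
    have hρi : ∀ i, ρbar ≤ ε * c i ^ 2 * qd i * A t ^ 2 / 4 - 8 * ε ^ 2 * c i ^ 2 / (dmin * (t₁ - t₀) ^ 2) := by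
      intro i
      have hcc : cbar ^ 2 ≤ c i ^ 2 := pow_le_pow_left₀ hcbar (hc i) 2
      have hcc' : c i ^ 2 ≤ chi ^ 2 := pow_le_pow_left₀ (hci i) (hchi i) 2
      have hA2' : 0 ≤ A t ^ 2 := sq_nonneg _
      have p1 : ε * cbar ^ 2 * qbar * A t ^ 2 / 4 ≤ ε * c i ^ 2 * qd i * A t ^ 2 / 4 := by
        have h1 : cbar ^ 2 * qbar ≤ c i ^ 2 * qd i := mul_le_mul hcc (hq i) hqbar (sq_nonneg (c i))
        have h2 := mul_le_mul_of_nonneg_left h1 (mul_nonneg hε hA2')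
        have e1 : ε * cbar ^ 2 * qbar * A t ^ 2 / 4 = ε * A t ^ 2 * (cbar ^ 2 * qbar) / 4 := by ring
        have e2 : ε * c i ^ 2 * qd i * A t ^ 2 / 4 = ε * A t ^ 2 * (c i ^ 2 * qd i) / 4 := by ring
        rw [e1, e2]; linarith
      have p2 : 8 * ε ^ 2 * c i ^ 2 / (dmin * (t₁ - t₀) ^ 2) ≤ 8 * ε ^ 2 * chi ^ 2 / (dmin * (t₁ - t₀) ^ 2) := by
        apply div_le_div_of_nonneg_right _ (by positivity)
        exact mul_le_mul_of_nonneg_left hcc' (by positivity)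
      rw [hρbar]; linarith
    -- per chain: chain inequality + slack + rate
    have hfin : ∀ i, μ * (-2 * S5 i + ε * xd i + ε * (c i * Ad t) * Y i t) + μ * G i ≤ -σ t * (μ * n5 i) := by
      intro i
      have hchain := pointwise_chain_ineq (A := A t) (Ad := Ad t) (T := t₁ - t₀) (S := S5 i) (x := xd i) hμ hε (hci i) hdmin (hd0 i) hTpos
        (hformt i) (hqwt i) (rampR3_pairing_le (q0 i) (w0 i t) (wp i t) (wm i t)) hA2
      have hsl := chain_slack_le (PP := ‖wpp i t‖ ^ 2 + ‖wmm i t‖ ^ 2) hμ.le (sq_nonneg ‖w0 i t‖) hchain (hρi i)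
      have hrate := min_rate_le (ρbar := ρbar) (a := 7 * dmin / 8) (b := dtwo) (X := μ * ‖w0 i t‖ ^ 2) (P := μ * (‖wp i t‖ ^ 2 + ‖wm i t‖ ^ 2))
        (PP := μ * (‖wpp i t‖ ^ 2 + ‖wmm i t‖ ^ 2)) (by positivity) (by positivity) (by positivity)
      have en : μ * ‖w0 i t‖ ^ 2 + μ * (‖wp i t‖ ^ 2 + ‖wm i t‖ ^ 2) + μ * (‖wpp i t‖ ^ 2 + ‖wmm i t‖ ^ 2) = μ * n5 i := by
        simp only [hn5]; ring
      have eG : μ * G i = μ * (ε * c i ^ 2 * qd i * A t ^ 2 / 4 * ‖w0 i t‖ ^ 2 + dmin / 8 * (‖wp i t‖ ^ 2 + ‖wm i t‖ ^ 2)) := by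
        simp only [hG]
      rw [← en, eG, show σ t = min ρbar (min (7 * dmin / 8) dtwo) by simp only [hσ, hρbar]]
      linarith [hsl, hrate]
    have hper := Finset.sum_le_sum fun i (_ : i ∈ Finset.univ) => hfin i
    -- forcing
    have hFsum : μ * (ε * ∑ i, Fi i) ≤ μ * (ε * ∑ i, Fb i) := by
      refine mul_le_mul_of_nonneg_left (mul_le_mul_of_nonneg_left (Finset.sum_le_sum fun i _ => ?_) hε) hμ.le
      exact (le_abs_self _).trans (hFi i).2
    -- sum algebra
    have e1 : ∑ i, (μ * (-2 * S5 i + ε * xd i + ε * (c i * Ad t) * Y i t) + μ * G i)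
        = -2 * (μ * ∑ i, S5 i) + μ * (ε * ∑ i, (c i * Ad t * Y i t + xd i + Fi i)) - μ * (ε * ∑ i, Fi i) + μ * ∑ i, G i := by
      simp only [Finset.mul_sum, ← Finset.sum_add_distrib, ← Finset.sum_sub_distrib]
      exact Finset.sum_congr rfl fun i _ => by ring
    have e4 : -σ t * (μ * ∑ i, n5 i) = ∑ i, (-σ t * (μ * n5 i)) := by rw [Finset.mul_sum, Finset.mul_sum]
    have hRle : -(7 * dmin / 8) * R ≤ -σ t * R := by
      have hmd : σ t ≤ 7 * dmin / 8 := (min_le_right _ _).trans (min_le_left _ _)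
      nlinarith [hmd, hR0]
    rw [hEeq]
    have hper' : -2 * (μ * ∑ i, S5 i) + μ * (ε * ∑ i, (c i * Ad t * Y i t + xd i + Fi i)) - μ * (ε * ∑ i, Fi i) + μ * ∑ i, G i
        ≤ -σ t * (μ * ∑ i, n5 i) := by rw [← e1, e4]; exact hper
    have hFt' : μ * (ε * ∑ i, Fb i) ≤ μ * ∑ i, G i + dmin / 8 * R := hFt
    have hQ' : μ * ∑ i, S5 i + dmin / 2 * R ≤ Q t := hQt
    have eσ : -σ t * (μ * ∑ i, n5 i + R) = -σ t * (μ * ∑ i, n5 i) + (-σ t * R) := by ring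
    rw [eσ]
    linarith [hper', hFsum, hFt', hRle, hQ']
  -- (5) sandwich `7E/8 ≤ Φ ≤ 9E/8`, `Φ = E` at the ends
  have hεc : ∀ i, ε * c i * Real.sqrt 2 / 2 ≤ 1 / 8 := fun i => eps_c_sqrt_two_le hε (hci i) hdmin hdD (c1 i) c2
  have hsand : ∀ t ∈ Icc t₀ t₁, |μ * (ε * ∑ i, X i t)| ≤ E t / 8 := by
    intro t htI
    obtain ⟨hA0t, hA1t⟩ := hA01 t htI
    have hXi : ∀ i, |ε * X i t| ≤ 1 / 8 * (‖w0 i t‖ ^ 2 + ‖wp i t‖ ^ 2 + ‖wm i t‖ ^ 2 + ‖wpp i t‖ ^ 2 + ‖wmm i t‖ ^ 2) := by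
      intro i
      have h3 := threeModeR3_equiv (c i * A t) ε (q0 i) (w0 i t) (wp i t) (wm i t) (mul_nonneg (hci i) hA0t) hε
      rw [← hXbR i t] at h3
      exact sandwich_term_le hε (hci i) hA1t h3 (hεc i)
    rw [abs_mul, abs_of_pos hμ, abs_mul, abs_of_nonneg hε]
    have hsumX : |∑ i, X i t| ≤ ∑ i, |X i t| := Finset.abs_sum_le_sum_abs _ _
    have hXi' : ∀ i, ε * |X i t| ≤ 1 / 8 * (‖w0 i t‖ ^ 2 + ‖wp i t‖ ^ 2 + ‖wm i t‖ ^ 2 + ‖wpp i t‖ ^ 2 + ‖wmm i t‖ ^ 2) := by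
      intro i; have := hXi i; rwa [abs_mul, abs_of_nonneg hε] at this
    have hsum8 : ε * ∑ i, |X i t| ≤ 1 / 8 * ∑ i, (‖w0 i t‖ ^ 2 + ‖wp i t‖ ^ 2 + ‖wm i t‖ ^ 2 + ‖wpp i t‖ ^ 2 + ‖wmm i t‖ ^ 2) := by
      rw [Finset.mul_sum, Finset.mul_sum]; exact Finset.sum_le_sum fun i _ => hXi' i
    have hE5t := hE5 t htI
    calc μ * (ε * |∑ i, X i t|) ≤ μ * (ε * ∑ i, |X i t|) := mul_le_mul_of_nonneg_left (mul_le_mul_of_nonneg_left hsumX hε) hμ.le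
      _ ≤ μ * (1 / 8 * ∑ i, (‖w0 i t‖ ^ 2 + ‖wp i t‖ ^ 2 + ‖wm i t‖ ^ 2 + ‖wpp i t‖ ^ 2 + ‖wmm i t‖ ^ 2)) := mul_le_mul_of_nonneg_left hsum8 hμ.le
      _ = 1 / 8 * (μ * ∑ i, (‖w0 i t‖ ^ 2 + ‖wp i t‖ ^ 2 + ‖wm i t‖ ^ 2 + ‖wpp i t‖ ^ 2 + ‖wmm i t‖ ^ 2)) := by ring
      _ ≤ 1 / 8 * E t := mul_le_mul_of_nonneg_left hE5t (by norm_num)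
      _ = E t / 8 := by ring
  have hlo' : ∀ t ∈ Icc t₀ t₁, 7 / 8 * E t ≤ Φ t := fun t htI => by
    have h := hsand t htI
    have := neg_abs_le (μ * (ε * ∑ i, X i t))
    show 7 / 8 * E t ≤ E t + μ * (ε * ∑ i, X i t)
    linarith
  have hhi' : ∀ t ∈ Icc t₀ t₁, Φ t ≤ 9 / 8 * E t := fun t htI => by
    have h := hsand t htI
    have := le_abs_self (μ * (ε * ∑ i, X i t))
    show E t + μ * (ε * ∑ i, X i t) ≤ 9 / 8 * E t
    linarith
  have hX0 : ∀ i, X i t₀ = 0 := fun i => by show (c i * A t₀) * Y i t₀ = 0; rw [hA0, mul_zero, zero_mul]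
  have hX1 : ∀ i, X i t₁ = 0 := fun i => by show (c i * A t₁) * Y i t₁ = 0; rw [hA1, mul_zero, zero_mul]
  have hΦ0 : Φ t₀ = E t₀ := by
    show E t₀ + μ * (ε * ∑ i, X i t₀) = E t₀
    rw [Finset.sum_eq_zero (fun i _ => hX0 i), mul_zero, mul_zero, add_zero]
  have hΦ1 : Φ t₁ = E t₁ := by
    show E t₁ + μ * (ε * ∑ i, X i t₁) = E t₁
    rw [Finset.sum_eq_zero (fun i _ => hX1 i), mul_zero, mul_zero, add_zero]
  -- (6) absolute continuity of `Φ`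
  have hYac : ∀ i, AbsolutelyContinuousOnInterval (Y i) t₀ t₁ := by
    intro i
    have hg : AbsolutelyContinuousOnInterval (fun s => transversalProjR (q0 i) (wp i s - wm i s)) t₀ t₁ :=
      ((hpac i).fun_sub (hmac i)).clm_comp ((transversalProjR (q0 i)).restrictScalars ℝ)
    have h := (h0ac i).re_inner (𝕜 := ℂ) hg
    simpa only [hY, RCLike.re_to_complex] using h
  have hXac : ∀ i, AbsolutelyContinuousOnInterval (X i) t₀ t₁ := by
    intro i
    have h := (hAac.const_mul (c i)).fun_mul (hYac i)
    simpa only [hX] using h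
  have hΦac : AbsolutelyContinuousOnInterval Φ t₀ t₁ := by
    have hs := CellChain.absolutelyContinuousOnInterval_finsetSum Finset.univ (fun i _ => hXac i)
    have h := hEac.fun_add ((hs.const_mul ε).const_mul μ)
    simpa only [hΦ] using h
  -- (7) the contraction
  have hσc : Continuous σ := by
    rw [hσ]
    exact (((continuous_const.mul (hAc.pow 2)).div_const _).sub continuous_const).min continuous_const
  -- choose the derivative a.e.
  have hderiv' : ∀ᵐ t, t ∈ uIcc t₀ t₁ → HasDerivAt Φ (deriv Φ t) t ∧ deriv Φ t ≤ -σ t * E t := by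
    filter_upwards [hderiv] with t ht htI
    obtain ⟨φ, hφ, hle⟩ := ht htI
    refine ⟨hφ.differentiableAt.hasDerivAt, ?_⟩
    rwa [hφ.deriv]
  have key := slot_contraction_ac (c₁ := 7 / 8) (c₂ := 9 / 8) ht (by norm_num) (by norm_num) hΦac (hderiv'.mono fun t ht htI => (ht htI).1) hσc
    (hderiv'.mono fun t ht htI => (ht htI).2) hlo' hhi' hΦ0 hΦ1
  simpa [hσ] using key

end Summit.AnomalousDissipation.AnomalousDissipation.Theorems.SolenoidalFractalHomogenisation.LagrangianStep.W7Slot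

end
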